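import Literature.NumberTheory.LFunctions.ChebyshevHalfLineBiasCharactersProofs
import Mathlib.NumberTheory.LSeries.PrimesInAP
import HarnessLib

/-!
# GRH-IMPLYING criterion for all `χ` mod `q` (Suzuki 2025, Thm 6 (i)), PROVED — «nothing here bears on the truth of RH»
# Landau's theorem for `Z₀(s) = (s − 1) Π_χ L(s, χ)`: a constant sign of (1.21) or (1.22) + no real zeros in `(β, 1)` ⟹ `L(s, χ) ≠ 0` on `β < Re s < 1` for every `χ` mod `q`

M. Suzuki, *On variants of Chebyshev's conjecture*, Ramanujan J. **68** (2025) 95 = arXiv:2411.07436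
[`Suzuki2025Chebyshev`; PUBLISHED, refereed], **Theorem 6 (i)** (§1.3), AS PRINTED: «Let `q` be a positive integer, and let
`β = β(q)` be a real number such that `1/2 ≤ β < 1` and `L(σ, χ) ≠ 0` for all `σ > β` and all Dirichlet character `χ` modulo
`q`. (i) Suppose that there exists `x₀ ≥ 2` such that either `Σ_{n ≤ x, n ≡ 1 mod q} Λ(n) n^{-1/2} log(x/n) − 4√x/φ(q)` (1.21)
has a constant sign for all `x ≥ x₀`, or `Σ_{n ≤ xe², n ≡ 1 mod q} Λ(n) n^{-1/2} log(x/n)` (1.22) has a constant sign for all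
`x ≥ x₀`. Then `L(s, χ) ≠ 0` in the right half-plane `Re(s) > β` for all `χ` modulo `q`. In particular, if `β = 1/2`, the GRH
for `L(s, χ)` holds for all Dirichlet characters `χ` modulo `q`.» — the named fact `Suzuki2025Chebyshev_thm6_i` of
`ChebyshevHalfLineBiasCharacters.lean`, DISCHARGED here: `Suzuki2025Chebyshev_thm6_i_holds`. A GRH-type CRITERION (an
implication from a zero-free hypothesis plus a sign condition); nothing in this file is, or is worded as, progress toward RH
or GRH. Theorems only (D-0014/D-0026); no definitions.

## The printed proof (§5.1) and this formalisation

§5.1: «By the orthogonality of Dirichlet characters, `Σ_{n ≤ x, n ≡ 1 (q)} Λ(n) n^{-1/2} log(x/n) = φ(q)^{-1} Σ_χ g_χ(x)` (5.1) …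
`∫_1^∞ (…(1.21)…) x^{-s-1/2} dx = −(s − ½)^{-2} φ(q)^{-1} Σ_χ (L'/L)(s, χ) − 4/(φ(q)(s − 1))` (5.4), whose right-hand side is
regular at `s = 1` (the pole of `(L'/L)(s, χ₀)` is cancelled) … (5.6) for (1.22) with the factor `2(1 − s)` … Proposition 1
[Landau] … forces `Π_χ L(s, χ) ≠ 0` in `Re(s) > β`.»

Here (Landau variable `S = s − ½`, `x = e^t`):
* `Z₀(s) := LFunctionTrivChar₁ q s · Π_{χ ≠ χ₀} L(s, χ)` (Mathlib's entire `(s − 1)L(s, χ₀)` times the entire non-principal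
  `L`-functions) is ENTIRE, non-zero on `Re s ≥ 1` (Mathlib's non-vanishing; at `s = 1` the residue factor) and at real
  `β < σ < 1` (hypothesis); `(Z₀'/Z₀)(w) = 1/(w − 1) + Σ_χ (L'/L)(w, χ)` for `Re w > 1` (`logDeriv_mul`, `logDeriv_prod`).
* (5.1)/(5.4) in Dirichlet-series form is Mathlib's `ArithmeticFunction.vonMangoldt.LSeries_residueClass_eq`:
  `L(Λ𝟙_{n ≡ 1 (q)}, w) = −φ(q)^{-1} Σ_χ (L'/L)(w, χ)` (`Re w > 1`).
* Case (1.21): `G = η(φ_d − (4/φ(q)) e^{t/2})`, `d = Λ𝟙_{n ≡ 1 (q)} ∈ [0, Λ]`, `η = ±1` the constant sign; with the tree's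
  `HalfLinePrimeOnlyLandau.integral_weighted_mul_cexp` and `∫₀^∞ e^{t/2} e^{−St} dt = 1/(S − ½)`:
  `∫₀^∞ G e^{−St} dt = (c·(Z₀'/Z₀)(½+S) + P(S))/S²` with `c = −η/φ(q)`, `P(S) = −2η(2S+1)/φ(q)` — the pole at `S = ½`
  cancels, exactly as printed after (5.4).
* Case (1.22): at `x = e^{u−2}`, (1.22) is `φ_d(u) − 2A_d(u)` (`A_d(u) = Σ_{n ≤ e^u} d(n)/√n`, transform `S^{-1}L(d, ½+S)`:
  `HalfLinePrimeOnlyLandau.integral_count_mul_cexp`), so `H = η(φ_d − 2A_d)` is one-signed beyond `log x₀ + 2` and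
  `∫₀^∞ H e^{−Su} du = η(1 − 2S)S^{-2} L(d, ½+S) = (c(S)(Z₀'/Z₀)(½+S) + P)/S²`, `c(S) = −η(1−2S)/φ(q)`, `P = −2η/φ(q)` (the
  printed factor `2(1 − s)` of (5.6)).
* Landau's theorem: the tree's `DirichletHalfLineLandau.entire_ne_zero_of_laplace_eq` gives `Z₀ ≠ 0` on `Re s > β`, hence
  `L(s, χ) ≠ 0` for `β < Re s`, `s ≠ 1`, every `χ`.
* «In particular» (`β = ½`): for `χ ≠ χ₀` the tree's `DirichletHalfLineLandau.riemannHypothesis_of_forall_ne_zero`; for `χ₀`,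
  `L(s, χ₀) = Π_{p ∣ q}(1 − p^{-s}) ζ(s)` (Mathlib `LFunctionTrivChar_eq_mul_riemannZeta`; the Euler factors vanish only on
  `Re s = 0`) and a zero of `ζ` with `0 < Re s < ½` reflects to `1 − s` (the tree's `GeneralizedRH.riemannZeta_one_sub_eq_zero`).

## References
* [Suzuki2025Chebyshev] M. Suzuki, Ramanujan J. 68 (2025) 95 = arXiv:2411.07436: §1.3 Thm 6 (i); §5.1 (5.1)–(5.6); §2 Prop 1.
* [MontgomeryVaughan2007] H. L. Montgomery, R. C. Vaughan, *Multiplicative Number Theory I*, §15.1 Lemma 15.1 (Landau); §11.3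
  (orthogonality and `−Σ' Λ(n)χ(n)n^{-s}`), §10.1.
-/

noncomputable section

open Complex Filter Topology Set MeasureTheory ArithmeticFunction
open scoped Real LSeries.notation

namespace Literature.NumberTheory.LFunctions

namespace SuzukiProgressions

open DirichletCharacter

variable {q : ℕ} [NeZero q]

/-! ### The entire function `Z₀(s) = (s − 1) L(s, χ₀) · Π_{χ ≠ χ₀} L(s, χ)` -/

/-- `Z₀` is entire. [folklore] -/
private theorem differentiable_Z :
    Differentiable ℂ (fun s : ℂ ↦ LFunctionTrivChar₁ q s *
      ∏ χ ∈ Finset.univ.erase (1 : DirichletCharacter ℂ q), χ.LFunction s) :=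
  (differentiable_LFunctionTrivChar₁ q).mul
    (Differentiable.fun_finsetProd fun _ hχ ↦ differentiable_LFunction (Finset.ne_of_mem_erase hχ))

/-- For `s ≠ 1`: if every `L(s, χ) ≠ 0` then `Z₀(s) ≠ 0`. [folklore] -/
private theorem Z_ne_zero_of_forall {s : ℂ} (hs : s ≠ 1)
    (h : ∀ χ : DirichletCharacter ℂ q, χ.LFunction s ≠ 0) :
    LFunctionTrivChar₁ q s * ∏ χ ∈ Finset.univ.erase (1 : DirichletCharacter ℂ q), χ.LFunction s ≠ 0 := by
  refine mul_ne_zero ?_ (Finset.prod_ne_zero_iff.2 fun χ _ ↦ h χ)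
  rw [LFunctionTrivChar₁, Function.update_of_ne hs]
  exact mul_ne_zero (sub_ne_zero.2 hs) (h 1)

/-- For `s ≠ 1`: `Z₀(s) ≠ 0` gives `L(s, χ) ≠ 0` for every `χ`. [folklore] -/
private theorem ne_zero_of_Z {s : ℂ} (hs : s ≠ 1)
    (h : LFunctionTrivChar₁ q s * ∏ χ ∈ Finset.univ.erase (1 : DirichletCharacter ℂ q), χ.LFunction s ≠ 0)
    (χ : DirichletCharacter ℂ q) : χ.LFunction s ≠ 0 := by
  rcases eq_or_ne χ 1 with rfl | hχ
  · have h1 := left_ne_zero_of_mul h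
    rw [LFunctionTrivChar₁, Function.update_of_ne hs] at h1
    exact right_ne_zero_of_mul h1
  · exact (Finset.prod_ne_zero_iff.1 (right_ne_zero_of_mul h)) χ (Finset.mem_erase.2 ⟨hχ, Finset.mem_univ _⟩)

/-- `Z₀ ≠ 0` on `Re s ≥ 1`. [folklore] -/
private theorem Z_ne_zero_of_one_le_re {s : ℂ} (hs : 1 ≤ s.re) :
    LFunctionTrivChar₁ q s * ∏ χ ∈ Finset.univ.erase (1 : DirichletCharacter ℂ q), χ.LFunction s ≠ 0 := by
  rcases eq_or_ne s 1 with rfl | hs1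
  · refine mul_ne_zero (LFunctionTrivChar₁_apply_one_ne_zero q) (Finset.prod_ne_zero_iff.2 fun χ hχ ↦ ?_)
    exact LFunction_ne_zero_of_one_le_re χ (Or.inl (Finset.ne_of_mem_erase hχ)) hs
  · exact Z_ne_zero_of_forall hs1 fun χ ↦ LFunction_ne_zero_of_one_le_re χ (Or.inr hs1) hs

/-- For `Re w > 1`: `(Z₀'/Z₀)(w) = 1/(w − 1) + Σ_χ (L'/L)(w, χ)`. [folklore] -/
private theorem logDeriv_Z {w : ℂ} (hw : 1 < w.re) :
    logDeriv (fun s : ℂ ↦ LFunctionTrivChar₁ q s *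
      ∏ χ ∈ Finset.univ.erase (1 : DirichletCharacter ℂ q), χ.LFunction s) w =
      1 / (w - 1) + ∑ χ : DirichletCharacter ℂ q, logDeriv χ.LFunction w := by
  have hw1 : w ≠ 1 := fun h ↦ by rw [h, one_re] at hw; exact lt_irrefl _ hw
  have hL : ∀ χ : DirichletCharacter ℂ q, χ.LFunction w ≠ 0 := fun χ ↦
    LFunction_ne_zero_of_one_le_re χ (Or.inr hw1) hw.le
  have hdχ : ∀ χ ∈ Finset.univ.erase (1 : DirichletCharacter ℂ q), DifferentiableAt ℂ χ.LFunction w :=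
    fun χ hχ ↦ differentiable_LFunction (Finset.ne_of_mem_erase hχ) w
  have hd1 : DifferentiableAt ℂ (1 : DirichletCharacter ℂ q).LFunction w :=
    differentiableAt_LFunction _ w (Or.inl hw1)
  -- the first factor agrees with `(s − 1) L(s, χ₀)` near `w`
  have hev : LFunctionTrivChar₁ q =ᶠ[𝓝 w] fun s ↦ (s - 1) * (1 : DirichletCharacter ℂ q).LFunction s := by
    filter_upwards [isOpen_ne.mem_nhds hw1] with s hs
    rw [LFunctionTrivChar₁, Function.update_of_ne hs]
  have hA0 : LFunctionTrivChar₁ q w ≠ 0 := by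
    rw [hev.eq_of_nhds]
    exact mul_ne_zero (sub_ne_zero.2 hw1) (hL 1)
  have hA : logDeriv (LFunctionTrivChar₁ q) w = 1 / (w - 1) + logDeriv (1 : DirichletCharacter ℂ q).LFunction w := by
    have h1 : logDeriv (LFunctionTrivChar₁ q) w =
        logDeriv (fun s ↦ (s - 1) * (1 : DirichletCharacter ℂ q).LFunction s) w := by
      rw [logDeriv_apply, logDeriv_apply, hev.deriv_eq, hev.eq_of_nhds]
    rw [h1, logDeriv_mul (f := fun s : ℂ ↦ s - 1) (g := (1 : DirichletCharacter ℂ q).LFunction) w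
      (sub_ne_zero.2 hw1) (hL 1) (by fun_prop) hd1]
    congr 1
    rw [logDeriv_apply, deriv_sub_const, deriv_id'', one_div]
  have hB0 : ∏ χ ∈ Finset.univ.erase (1 : DirichletCharacter ℂ q), χ.LFunction w ≠ 0 :=
    Finset.prod_ne_zero_iff.2 fun χ _ ↦ hL χ
  have hdB : DifferentiableAt ℂ
      (fun s : ℂ ↦ ∏ χ ∈ Finset.univ.erase (1 : DirichletCharacter ℂ q), χ.LFunction s) w :=
    DifferentiableAt.fun_finsetProd hdχ
  rw [logDeriv_mul (f := LFunctionTrivChar₁ q)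
      (g := fun s : ℂ ↦ ∏ χ ∈ Finset.univ.erase (1 : DirichletCharacter ℂ q), χ.LFunction s) w hA0 hB0
      ((differentiable_LFunctionTrivChar₁ q) w) hdB, hA,
    logDeriv_prod (s := Finset.univ.erase (1 : DirichletCharacter ℂ q)) (f := fun χ ↦ χ.LFunction) (x := w)
      (fun χ _ ↦ hL χ) hdχ, add_assoc,
    Finset.add_sum_erase Finset.univ (fun χ : DirichletCharacter ℂ q ↦ logDeriv χ.LFunction w) (Finset.mem_univ _)]

/-- Suzuki (5.1)/(5.4) in Dirichlet-series form (Mathlib's `LSeries_residueClass_eq` at `a = 1`): for `Re w > 1`,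
`L(Λ𝟙_{n ≡ 1 (q)}, w) = −φ(q)^{-1} Σ_χ (L'/L)(w, χ)`. [cite: Suzuki2025Chebyshev, §5.1 (5.1)–(5.4)] -/
theorem LSeries_residueClass_one {w : ℂ} (hw : 1 < w.re) :
    L (fun n ↦ ((vonMangoldt.residueClass (1 : ZMod q) n : ℝ) : ℂ)) w =
      -(q.totient : ℂ)⁻¹ * ∑ χ : DirichletCharacter ℂ q, logDeriv χ.LFunction w := by
  have h := vonMangoldt.LSeries_residueClass_eq (isUnit_one (M := ZMod q)) hw
  simp only [ZMod.inv_one, map_one, one_mul] at h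
  rw [show (fun n ↦ ((vonMangoldt.residueClass (1 : ZMod q) n : ℝ) : ℂ)) = ↗(vonMangoldt.residueClass (1 : ZMod q)) from rfl, h]
  simp only [logDeriv_apply]

/-! ### The one-signed functions and their transforms -/

/-- `A_d(t) = Σ_{n ≤ e^t} d(n)/√n` is monotone for `d ≥ 0`. [folklore] -/
private theorem monotone_count {d : ℕ → ℝ} (hd0 : ∀ n, 0 ≤ d n) :
    Monotone fun t : ℝ ↦ ∑ n ∈ Finset.Icc 1 ⌊Real.exp t⌋₊, d n / Real.sqrt n := by
  intro t u htu
  refine Finset.sum_le_sum_of_subset_of_nonneg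
    (Finset.Icc_subset_Icc_right (Nat.floor_mono (Real.exp_le_exp.2 htu))) fun n _ _ ↦ ?_
  exact div_nonneg (hd0 n) (Real.sqrt_nonneg _)

/-- `B_d(t) = Σ_{n ≤ e^t} d(n) log n/√n` is monotone for `d ≥ 0`. [folklore] -/
private theorem monotone_countLog {d : ℕ → ℝ} (hd0 : ∀ n, 0 ≤ d n) :
    Monotone fun t : ℝ ↦ ∑ n ∈ Finset.Icc 1 ⌊Real.exp t⌋₊, d n / Real.sqrt n * Real.log n := by
  intro t u htu
  refine Finset.sum_le_sum_of_subset_of_nonneg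
    (Finset.Icc_subset_Icc_right (Nat.floor_mono (Real.exp_le_exp.2 htu))) fun n _ _ ↦ ?_
  exact mul_nonneg (div_nonneg (hd0 n) (Real.sqrt_nonneg _)) (Real.log_natCast_nonneg n)

/-- `φ_d(t) = Σ_{n ≤ e^t} d(n)/√n (t − log n) = t A_d(t) − B_d(t)` is measurable. [folklore] -/
private theorem measurable_weighted {d : ℕ → ℝ} (hd0 : ∀ n, 0 ≤ d n) :
    Measurable fun t : ℝ ↦ ∑ n ∈ Finset.Icc 1 ⌊Real.exp t⌋₊, d n / Real.sqrt n * (t - Real.log n) := by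
  have h : (fun t : ℝ ↦ ∑ n ∈ Finset.Icc 1 ⌊Real.exp t⌋₊, d n / Real.sqrt n * (t - Real.log n)) =
      fun t ↦ t * (∑ n ∈ Finset.Icc 1 ⌊Real.exp t⌋₊, d n / Real.sqrt n)
        - ∑ n ∈ Finset.Icc 1 ⌊Real.exp t⌋₊, d n / Real.sqrt n * Real.log n := by
    funext t
    rw [Finset.mul_sum, ← Finset.sum_sub_distrib]
    refine Finset.sum_congr rfl fun n _ ↦ ?_
    ring
  rw [h]
  exact (measurable_id.mul (monotone_count hd0).measurable).sub (monotone_countLog hd0).measurable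

/-- `∫₀^∞ e^{t/2} e^{−St} dt = 1/(S − 1/2)` for `Re S > 1/2`, with integrability. [folklore] -/
private theorem integral_exp_half_mul_cexp {s : ℂ} (hs : 1 / 2 < s.re) :
    IntegrableOn (fun t : ℝ ↦ ((Real.exp (t / 2) : ℝ) : ℂ) * cexp (-s * t)) (Ioi 0) ∧
      ∫ t in Ioi (0 : ℝ), ((Real.exp (t / 2) : ℝ) : ℂ) * cexp (-s * t) = 1 / (s - 1 / 2) := by
  have ha : ((1 / 2 : ℂ) - s).re < 0 := by simp; linarith
  have hne : (1 / 2 : ℂ) - s ≠ 0 := fun h ↦ by rw [h, zero_re] at ha; exact lt_irrefl _ ha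
  have hne' : s - 1 / 2 ≠ 0 := fun h ↦ hne (by rw [← neg_sub, h, neg_zero])
  have heq : ∀ t : ℝ, ((Real.exp (t / 2) : ℝ) : ℂ) * cexp (-s * t) = cexp (((1 / 2 : ℂ) - s) * t) := by
    intro t
    rw [Complex.ofReal_exp, ← Complex.exp_add]
    congr 1
    push_cast
    ring
  simp_rw [heq]
  refine ⟨integrableOn_exp_mul_complex_Ioi ha 0, ?_⟩
  rw [integral_exp_mul_complex_Ioi ha 0, Complex.ofReal_zero, mul_zero, Complex.exp_zero,
    show (1 / 2 : ℂ) - s = -(s - 1 / 2) by ring, div_neg, neg_div, neg_neg]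

omit [NeZero q] in
/-- The sum (1.21)/(1.22) over `n ≡ 1 (mod q)` as a sum of `d = Λ𝟙_{n ≡ 1 (q)}` over all `n ≤ y`, at `x = e^τ`:
`Σ_{n ≤ y, n ≡ 1} Λ(n)/√n · log(e^τ/n) = Σ_{n ≤ y} d(n)/√n (τ − log n)`. [folklore] -/
private theorem sum_filter_eq_sum_residueClass (τ : ℝ) (N : ℕ) :
    ∑ n ∈ (Finset.Icc 1 N).filter (fun n : ℕ ↦ (n : ZMod q) = 1),
        Λ n / Real.sqrt n * Real.log (Real.exp τ / n) =
      ∑ n ∈ Finset.Icc 1 N, vonMangoldt.residueClass (1 : ZMod q) n / Real.sqrt n * (τ - Real.log n) := by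
  rw [Finset.sum_filter]
  refine Finset.sum_congr rfl fun n hn ↦ ?_
  rw [Finset.mem_Icc] at hn
  have hn0 : (0 : ℝ) < n := by exact_mod_cast hn.1
  simp only [vonMangoldt.residueClass, Set.indicator_apply, Set.mem_setOf_eq]
  split_ifs
  · rw [Real.log_div (Real.exp_pos τ).ne' hn0.ne', Real.log_exp]
  · simp

end SuzukiProgressions

/-! ## Theorem 6 (i) -/

open SuzukiProgressions DirichletCharacter in
/-- **Suzuki 2025, Theorem 6 (i), PROVED** — discharge of the named fact `Suzuki2025Chebyshev_thm6_i`: for `q ≥ 1` and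
`½ ≤ β < 1` with `L(σ, χ) ≠ 0` for `β < σ < 1` and all `χ` mod `q`, a constant sign of (1.21) or of (1.22) for all large `x`
gives `L(s, χ) ≠ 0` for `β < Re s < 1` and every `χ` mod `q`, and for `β = ½` the GRH for every `L(s, χ)`, `χ` mod `q`.
Proof along §5.1 with `Z₀(s) = (s − 1)Π_χ L(s, χ)` and Landau's theorem (module docstring).
[cite: Suzuki2025Chebyshev, §1.3 Thm 6 (i); §5.1 (5.1)–(5.6); §2 Prop 1] -/
theorem Suzuki2025Chebyshev_thm6_i_holds : Suzuki2025Chebyshev_thm6_i := by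
  intro q _ β hβ hβ1 hzfree hsign
  obtain ⟨x₀, hx₀2, hx₀⟩ := hsign
  have hx₀0 : 0 < x₀ := by linarith
  have hφ0 : (q.totient : ℂ) ≠ 0 := by exact_mod_cast (Nat.totient_pos.mpr (NeZero.pos q)).ne'
  -- the coefficients `d = Λ𝟙_{n ≡ 1 (q)} ∈ [0, Λ]`
  set d : ℕ → ℝ := vonMangoldt.residueClass (1 : ZMod q) with hd_def
  have hd0 : ∀ n, 0 ≤ d n := vonMangoldt.residueClass_nonneg _
  have hdle : ∀ n, d n ≤ Λ n := vonMangoldt.residueClass_le _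
  -- `Z₀`
  set Z₀ : ℂ → ℂ := fun s : ℂ ↦ LFunctionTrivChar₁ q s *
    ∏ χ ∈ Finset.univ.erase (1 : DirichletCharacter ℂ q), χ.LFunction s with hZ₀_def
  have hZ₀d : Differentiable ℂ Z₀ := differentiable_Z
  have hZ₀right : ∀ s : ℂ, 1 ≤ s.re → Z₀ s ≠ 0 := fun s hs ↦ Z_ne_zero_of_one_le_re hs
  have hZ₀real : ∀ σ : ℝ, β < σ → σ < 1 → Z₀ σ ≠ 0 := fun σ h1 h2 ↦
    Z_ne_zero_of_forall (fun h ↦ by have := congrArg re h; simp at this; linarith) fun χ ↦ hzfree χ σ h1 h2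
  -- `L(d, ½+S)` through `Z₀'/Z₀`
  have hLd : ∀ s : ℂ, 1 < s.re →
      L (fun n ↦ (d n : ℂ)) (1 / 2 + s) = -(q.totient : ℂ)⁻¹ * (logDeriv Z₀ (1 / 2 + s) - 1 / (s - 1 / 2)) := by
    intro s hs
    have hw : 1 < (1 / 2 + s : ℂ).re := by simp; linarith
    rw [hd_def, LSeries_residueClass_one hw, hZ₀_def, logDeriv_Z hw]
    congr 1
    rw [show (1 / 2 : ℂ) + s - 1 = s - 1 / 2 by ring]
    ring
  -- Landau: `Z₀ ≠ 0` on `Re s > β`, in either case of the hypothesis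
  have hZ : ∀ s : ℂ, β < s.re → Z₀ s ≠ 0 := by
    rcases hx₀ with h121 | h122
    · -- case (1.21): the sign `η`
      obtain ⟨η, hη, hpos⟩ : ∃ η : ℝ, (η = 1 ∨ η = -1) ∧ ∀ x : ℝ, x₀ ≤ x →
          0 ≤ η * (∑ n ∈ (Finset.Icc 1 ⌊x⌋₊).filter (fun n : ℕ ↦ (n : ZMod q) = 1),
            Λ n / Real.sqrt n * Real.log (x / n) - 4 * Real.sqrt x / Nat.totient q) := by
        rcases h121 with h | h
        · exact ⟨1, Or.inl rfl, fun x hx ↦ by rw [one_mul]; exact h x hx⟩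
        · exact ⟨-1, Or.inr rfl, fun x hx ↦ by rw [neg_one_mul, neg_nonneg]; exact h x hx⟩
      have hη0 : (η : ℂ) ≠ 0 := by rcases hη with rfl | rfl <;> norm_num
      set G : ℝ → ℝ := fun t ↦ η *
        ((∑ n ∈ Finset.Icc 1 ⌊Real.exp t⌋₊, d n / Real.sqrt n * (t - Real.log n))
          - 4 * Real.exp (t / 2) / Nat.totient q) with hG_def
      have hGm : Measurable G :=
        ((measurable_weighted hd0).sub (by fun_prop)).const_mul η
      refine DirichletHalfLineLandau.entire_ne_zero_of_laplace_eq hZ₀d hZ₀right hβ hZ₀real hGm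
        (t₀ := Real.log x₀) (fun t ht ↦ ?_) ?_ (c := fun _ ↦ -(η : ℂ) * (q.totient : ℂ)⁻¹)
        (P := fun s ↦ -2 * (η : ℂ) * (q.totient : ℂ)⁻¹ * (2 * s + 1))
        (by fun_prop) (fun _ _ _ ↦ ?_) (by fun_prop) (fun s hs ↦ ?_)
      · -- non-negativity beyond `log x₀`
        have hxx : x₀ ≤ Real.exp t := by
          rw [← Real.exp_log hx₀0]
          exact (Real.exp_lt_exp.2 ht).le
        have hS := hpos (Real.exp t) hxx
        rw [sum_filter_eq_sum_residueClass, ← Real.exp_half] at hS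
        exact hS
      · -- integrability of `G(t) e^{−t}`
        obtain ⟨hi₁, -⟩ := HalfLinePrimeOnlyLandau.integral_weighted_mul_cexp (d := d) (a := -1) hd0 hdle
          (by norm_num)
        obtain ⟨hi₂, -⟩ := integral_exp_half_mul_cexp (s := 1) (by norm_num)
        have heq : EqOn (fun t : ℝ ↦ (G t : ℂ) * cexp (-(1 : ℂ) * t))
            (fun t ↦ (η : ℂ) *
              (((∑ n ∈ Finset.Icc 1 ⌊Real.exp t⌋₊, d n / Real.sqrt n * (t - Real.log n) : ℝ) : ℂ) *
                  cexp (-1 * (t : ℂ))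
                - (4 / (q.totient : ℂ)) * (((Real.exp (t / 2) : ℝ) : ℂ) * cexp (-(1 : ℂ) * t)))) (Ioi 0) := by
          intro t _
          simp only [hG_def]
          push_cast
          ring
        rw [integrableOn_congr_fun heq measurableSet_Ioi]
        exact (hi₁.sub (hi₂.const_mul _)).const_mul _
      · -- `c ≠ 0`
        exact mul_ne_zero (neg_ne_zero.2 hη0) (inv_ne_zero hφ0)
      · -- the transform for `Re S > 1`
        have ha : (-s).re < -1 / 2 := by simp; linarith
        have hs' : 1 / 2 < s.re := by linarith
        obtain ⟨hi₁, hI₁⟩ := HalfLinePrimeOnlyLandau.integral_weighted_mul_cexp (d := d) hd0 hdle ha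
        obtain ⟨hi₂, hI₂⟩ := integral_exp_half_mul_cexp hs'
        have heq : EqOn (fun t : ℝ ↦ (G t : ℂ) * cexp (-s * t))
            (fun t ↦ (η : ℂ) *
              (((∑ n ∈ Finset.Icc 1 ⌊Real.exp t⌋₊, d n / Real.sqrt n * (t - Real.log n) : ℝ) : ℂ) *
                  cexp (-s * t)
                - (4 / (q.totient : ℂ)) * (((Real.exp (t / 2) : ℝ) : ℂ) * cexp (-s * t)))) (Ioi 0) := by
          intro t _
          simp only [hG_def]
          push_cast
          ring
        rw [setIntegral_congr_fun measurableSet_Ioi heq, integral_const_mul, integral_sub hi₁ (hi₂.const_mul _),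
          integral_const_mul, hI₁, hI₂, show (1 / 2 : ℂ) - -s = 1 / 2 + s by ring, hLd s hs]
        have hs0 : s ≠ 0 := fun h ↦ by rw [h, zero_re] at hs; linarith
        have hs2 : s - 1 / 2 ≠ 0 := fun h ↦ by
          have := congrArg re h
          simp at this
          linarith
        have hs3 : (-1 + s * 2 : ℂ) ≠ 0 := fun h ↦ hs2 (by linear_combination h / 2)
        have hs4 : (2 * s - 1 : ℂ) ≠ 0 := fun h ↦ hs2 (by linear_combination h / 2)
        have hs5 : (s * 2 - 1 : ℂ) ≠ 0 := fun h ↦ hs2 (by linear_combination h / 2)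
        have hs6 : (1 - s * 2 : ℂ) ≠ 0 := fun h ↦ hs2 (by linear_combination -h / 2)
        have hs7 : (1 - 2 * s : ℂ) ≠ 0 := fun h ↦ hs2 (by linear_combination -h / 2)
        rw [show (1 : ℂ) / (s - 1 / 2) = 2 / (2 * s - 1) by rw [div_eq_div_iff hs2 hs4]; ring]
        field_simp
        ring
    · -- case (1.22): the sign `η`
      obtain ⟨η, hη, hpos⟩ : ∃ η : ℝ, (η = 1 ∨ η = -1) ∧ ∀ x : ℝ, x₀ ≤ x →
          0 ≤ η * ∑ n ∈ (Finset.Icc 1 ⌊x * Real.exp 2⌋₊).filter (fun n : ℕ ↦ (n : ZMod q) = 1),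
            Λ n / Real.sqrt n * Real.log (x / n) := by
        rcases h122 with h | h
        · exact ⟨1, Or.inl rfl, fun x hx ↦ by rw [one_mul]; exact h x hx⟩
        · exact ⟨-1, Or.inr rfl, fun x hx ↦ by rw [neg_one_mul, neg_nonneg]; exact h x hx⟩
      have hη0 : (η : ℂ) ≠ 0 := by rcases hη with rfl | rfl <;> norm_num
      set H : ℝ → ℝ := fun u ↦ η *
        ((∑ n ∈ Finset.Icc 1 ⌊Real.exp u⌋₊, d n / Real.sqrt n * (u - Real.log n))
          - 2 * ∑ n ∈ Finset.Icc 1 ⌊Real.exp u⌋₊, d n / Real.sqrt n) with hH_def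
      have hHm : Measurable H :=
        ((measurable_weighted hd0).sub ((monotone_count hd0).measurable.const_mul 2)).const_mul η
      refine DirichletHalfLineLandau.entire_ne_zero_of_laplace_eq hZ₀d hZ₀right hβ hZ₀real hHm
        (t₀ := Real.log x₀ + 2) (fun u hu ↦ ?_) ?_ (c := fun s ↦ -(η : ℂ) * (q.totient : ℂ)⁻¹ * (1 - 2 * s))
        (P := fun _ ↦ -2 * (η : ℂ) * (q.totient : ℂ)⁻¹)
        (by fun_prop) (fun s _ hs2 ↦ ?_) (by fun_prop) (fun s hs ↦ ?_)
      · -- non-negativity beyond `log x₀ + 2`, from the hypothesis at `x = e^{u−2}`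
        have hxx : x₀ ≤ Real.exp (u - 2) := by
          rw [← Real.exp_log hx₀0]
          exact (Real.exp_lt_exp.2 (by linarith)).le
        have hS := hpos (Real.exp (u - 2)) hxx
        rw [show Real.exp (u - 2) * Real.exp 2 = Real.exp u by rw [← Real.exp_add]; ring_nf,
          sum_filter_eq_sum_residueClass] at hS
        have hkey : H u = η * ∑ n ∈ Finset.Icc 1 ⌊Real.exp u⌋₊, d n / Real.sqrt n * (u - 2 - Real.log n) := by
          simp only [hH_def]
          congr 1
          rw [Finset.mul_sum, ← Finset.sum_sub_distrib]
          refine Finset.sum_congr rfl fun n _ ↦ ?_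
          ring
        rw [hkey]
        exact hS
      · -- integrability of `H(u) e^{−u}`
        obtain ⟨hi₁, -⟩ := HalfLinePrimeOnlyLandau.integral_weighted_mul_cexp (d := d) (a := -1) hd0 hdle
          (by norm_num)
        obtain ⟨hi₂, -⟩ := HalfLinePrimeOnlyLandau.integral_count_mul_cexp (d := d) (a := -1) hd0 hdle
          (by norm_num)
        have heq : EqOn (fun u : ℝ ↦ (H u : ℂ) * cexp (-(1 : ℂ) * u))
            (fun u ↦ (η : ℂ) *
              (((∑ n ∈ Finset.Icc 1 ⌊Real.exp u⌋₊, d n / Real.sqrt n * (u - Real.log n) : ℝ) : ℂ) *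
                  cexp (-1 * (u : ℂ))
                - 2 * (((∑ n ∈ Finset.Icc 1 ⌊Real.exp u⌋₊, d n / Real.sqrt n : ℝ) : ℂ) *
                  cexp (-1 * (u : ℂ))))) (Ioi 0) := by
          intro u _
          simp only [hH_def]
          push_cast
          ring
        rw [integrableOn_congr_fun heq measurableSet_Ioi]
        exact (hi₁.sub (hi₂.const_mul _)).const_mul _
      · -- `c(S) ≠ 0` for `Re S < 1/2`
        refine mul_ne_zero (mul_ne_zero (neg_ne_zero.2 hη0) (inv_ne_zero hφ0)) fun h ↦ ?_
        have := congrArg re h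
        simp at this
        linarith
      · -- the transform for `Re S > 1`
        have ha : (-s).re < -1 / 2 := by simp; linarith
        obtain ⟨hi₁, hI₁⟩ := HalfLinePrimeOnlyLandau.integral_weighted_mul_cexp (d := d) hd0 hdle ha
        obtain ⟨hi₂, hI₂⟩ := HalfLinePrimeOnlyLandau.integral_count_mul_cexp (d := d) hd0 hdle ha
        have heq : EqOn (fun u : ℝ ↦ (H u : ℂ) * cexp (-s * u))
            (fun u ↦ (η : ℂ) *
              (((∑ n ∈ Finset.Icc 1 ⌊Real.exp u⌋₊, d n / Real.sqrt n * (u - Real.log n) : ℝ) : ℂ) *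
                  cexp (-s * u)
                - 2 * (((∑ n ∈ Finset.Icc 1 ⌊Real.exp u⌋₊, d n / Real.sqrt n : ℝ) : ℂ) * cexp (-s * u))))
            (Ioi 0) := by
          intro u _
          simp only [hH_def]
          push_cast
          ring
        rw [setIntegral_congr_fun measurableSet_Ioi heq, integral_const_mul, integral_sub hi₁ (hi₂.const_mul _),
          integral_const_mul, hI₁, hI₂, show (1 / 2 : ℂ) - -s = 1 / 2 + s by ring, hLd s hs]
        have hs0 : s ≠ 0 := fun h ↦ by rw [h, zero_re] at hs; linarith
        have hs2 : s - 1 / 2 ≠ 0 := fun h ↦ by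
          have := congrArg re h
          simp at this
          linarith
        have hs3 : (-1 + s * 2 : ℂ) ≠ 0 := fun h ↦ hs2 (by linear_combination h / 2)
        have hs4 : (2 * s - 1 : ℂ) ≠ 0 := fun h ↦ hs2 (by linear_combination h / 2)
        have hs5 : (s * 2 - 1 : ℂ) ≠ 0 := fun h ↦ hs2 (by linear_combination h / 2)
        have hs6 : (1 - s * 2 : ℂ) ≠ 0 := fun h ↦ hs2 (by linear_combination -h / 2)
        have hs7 : (1 - 2 * s : ℂ) ≠ 0 := fun h ↦ hs2 (by linear_combination -h / 2)
        rw [show (1 : ℂ) / (s - 1 / 2) = 2 / (2 * s - 1) by rw [div_eq_div_iff hs2 hs4]; ring]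
        field_simp
        ring
  -- (a) `L(s, χ) ≠ 0` for `β < Re s`, `s ≠ 1`
  have hmain : ∀ χ : DirichletCharacter ℂ q, ∀ s : ℂ, β < s.re → s ≠ 1 → χ.LFunction s ≠ 0 :=
    fun χ s hs hs1 ↦ ne_zero_of_Z hs1 (hZ s hs) χ
  refine ⟨fun χ s hs hs1 ↦ hmain χ s hs (fun h ↦ by rw [h, one_re] at hs1; exact lt_irrefl _ hs1), ?_⟩
  -- (b) `β = 1/2`: GRH for every `χ`
  intro hβeq χ
  subst hβeq
  rcases ne_or_eq χ 1 with hχ | rfl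
  · refine DirichletHalfLineLandau.riemannHypothesis_of_forall_ne_zero hχ fun s hs ↦ ?_
    rcases eq_or_ne s 1 with rfl | hs1
    · exact LFunction_ne_zero_of_one_le_re χ (Or.inl hχ) (by simp)
    · exact hmain χ s hs hs1
  · -- the principal character: `L(s, χ₀) = Π_{p ∣ q}(1 − p^{-s}) ζ(s)`, reflect a zero with `Re s < 1/2`
    intro s h0 h0re h1re
    by_contra hne
    have hs1 : s ≠ 1 := fun h ↦ by rw [h, one_re] at h1re; exact lt_irrefl _ h1re
    rcases lt_or_gt_of_ne hne with hlt | hgt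
    · have hs0 : s ≠ 0 := fun h ↦ by rw [h, zero_re] at h0re; exact lt_irrefl _ h0re
      -- the Euler factors do not vanish in `Re s > 0`
      have heuler : ∀ w : ℂ, 0 < w.re → ∏ p ∈ q.primeFactors, (1 - (p : ℂ) ^ (-w)) ≠ 0 := by
        intro w hw
        refine Finset.prod_ne_zero_iff.2 fun p hp hzero ↦ ?_
        have hp := Nat.prime_of_mem_primeFactors hp
        have h1 : (p : ℂ) ^ (-w) = 1 := (sub_eq_zero.1 hzero).symm
        have hn : ‖(p : ℂ) ^ (-w)‖ = (p : ℝ) ^ (-w).re := Complex.norm_natCast_cpow_of_pos hp.pos _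
        rw [h1, norm_one] at hn
        have hlt : (p : ℝ) ^ (-w).re < 1 :=
          Real.rpow_lt_one_of_one_lt_of_neg (by exact_mod_cast hp.one_lt) (by simp; exact hw)
        linarith
      have hζ : riemannZeta s = 0 := by
        have h0' : LFunctionTrivChar q s = 0 := h0
        rw [LFunctionTrivChar_eq_mul_riemannZeta hs1, mul_eq_zero] at h0'
        exact h0'.resolve_left (heuler s h0re)
      have hζ' := GeneralizedRH.riemannZeta_one_sub_eq_zero hζ h0re h1re
      have h1s : (1 - s) ≠ 1 := fun h ↦ hs0 (by linear_combination -h)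
      have hL : LFunctionTrivChar q (1 - s) = 0 := by
        rw [LFunctionTrivChar_eq_mul_riemannZeta h1s, hζ', mul_zero]
      exact hmain 1 (1 - s) (by simp; linarith) h1s hL
    · exact hmain 1 s hgt hs1 h0

end Literature.NumberTheory.LFunctions

end
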